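import Summits.QuantumFields.YangMills.Theorems.FlatTubeReductionDressedSlowRate
import HarnessLib

/-!
# The SLOW-WITH-RATE clause WITH AN ADDITIVE SECOND-MOMENT POTENTIAL (skeleton «ratepack-v3 / frozen fibres»)
# (route `FlatTubeReduction`, crux K1 `NearFlatRatioLaw` stmt-QuantumFields-24720; seat `ym-line-ftr-p1` g12; R2b1 RECORD rung — no summit statement is proved here)

WHY (lead g12, crux workfile `Cruxes/NearFlatRatioLaw/Lines/ratepack-v3-frozen-g12.md`).  In the v3 package (`RateTube.SoftTubeBORatePackagePotOn`, p673515) the off-diagonal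
Feshbach coupling of a FROZEN fibre profile is budgeted by `√(b²‖u_a‖² + P a)` with `P a = κ_bγ·∫_{orbitDist<δ₁} orbitDist²·G_a²` (`G_a` the colour-averaged slow coefficient);
after the completed square the SLOW clause must absorb `(4/θ)σμ₀·P a`.  THIS FILE is g10's `slow_rate_clause_of_dressed` (p656642) with that potential carried along:
* `tubeCross_colourAvg_left/right` — the off-diagonal tube form is blind to the colour average in either slot (the gauge-averaged kernel is bi-invariant), so the
  off-diagonal brick may be stated for colour-INVARIANT slow amplitudes and applied to `G_a = colourAvg φ_a`;
* ★★★ `slow_rate_clause_of_dressed_pot` — from (B-N), (B-T)-rate upper and the DRESSED one-site no-intruder WITH POTENTIAL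
  (`hDOS′`: `∃ a ≠ 0, (⟨G_aW,K_BG_aW⟩ + κ_Eμ₀∫D·G_a²)μ₀ ≤ e^{ε'λ}μ_kμ₀‖G_a‖²`, no Gram condition — exactly the shape of `dressedOneOrbitRatePot_of_eigenMoments`):
  `∃ a ≠ 0, tubeForm β (u_a) + κ_E·σμ₀·γ·∫D·G_a² ≤ e^{ελ/4}·σ·μ_k·‖u_a‖²_w`, `u_a = Σ aᵢ·boProjAd w Ω 𝒰 fᵢ`, `G_a = colourAvg (boCoeffAd (Σ aᵢfᵢ))`.
HONEST FRAMING: assembly algebra for the rate twin; (B-T)-rate and the analytic bricks are OPEN; femto rung R2b1 (RECORD label) at fixed `L`; not infinite volume, not a gap,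
not Clay.  No defs, no named facts, no `sorry`.
-/

set_option autoImplicit false

noncomputable section

open MeasureTheory Filter Topology Real
open scoped BigOperators
open Literature.MathematicalPhysics.QuantumFieldTheory
open Literature.MathematicalPhysics.QuantumLattice

namespace Summit.QuantumFields.YangMills.Theorems.FemtoTransferGap.RateTube

open Summit.QuantumFields.YangMills.Theorems.FemtoTransferGap
open Summit.QuantumFields.YangMills.Theorems.FemtoTransferGap.TwoLattice.Avg
open Summit.QuantumFields.YangMills.Theorems.FemtoTransferGap.TwoLattice.ConstTube
open Summit.QuantumFields.YangMills.Theorems.FemtoTransferGap.TwoLattice.Stiff (LinkSpace)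

variable {L : ℕ} [NeZero L]

/-! ## §1 The off-diagonal tube form is blind to the colour average -/

/-- `X(f, colourAvg g) = X(f, g)`: the gauge-averaged kernel is invariant in its second slot. [cite: SeilerLNP1982, §3] -/
theorem tubeCross_colourAvg_right (β : ℝ) {f g : GaugeConfig 3 L SU2 → ℝ} (hg : Measurable g) {Cg : ℝ} (hCg : ∀ U, |g U| ≤ Cg) :
    tubeCross β f (colourAvg g) = tubeCross β f g := by
  obtain ⟨M, hM0, hM⟩ := exists_avgKernel_le (L := L) β
  have hinner : ∀ U, ∫ V, avgKernel β U V * colourAvg g V ∂configMeasure SU2 L = ∫ V, avgKernel β U V * g V ∂configMeasure SU2 L := fun U => by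
    have hKm := measurable_avgKernel_right β U
    have hKb : ∀ V, |avgKernel β U V| ≤ M := fun V => by rw [abs_of_pos (avgKernel_pos β U V)]; exact hM U V
    have hKinv : ∀ (c : SU2) (V : GaugeConfig 3 L SU2), avgKernel β U (gaugeTransform (fun _ : Site 3 L => c) V) = avgKernel β U V :=
      fun c V => avgKernel_gaugeTransform_right β _ U V
    have h1 := integral_colourAvg_mul_invariant hg hCg hKm hKb hKinv
    simp_rw [mul_comm (avgKernel β U _)]
    exact h1
  rw [tubeCross_eq_integral_mul, tubeCross_eq_integral_mul]
  simp_rw [hinner]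

/-- `X(colourAvg f, g) = X(f, g)`: the inner integral `∫ K̃(U,V) g(V) dV` is colour invariant in `U`. [cite: SeilerLNP1982, §3] -/
theorem tubeCross_colourAvg_left (β : ℝ) {f g : GaugeConfig 3 L SU2 → ℝ} (hf : Measurable f) {Cf : ℝ} (hCf : ∀ U, |f U| ≤ Cf) (hg : Measurable g) {Cg : ℝ}
    (hCg : ∀ U, |g U| ≤ Cg) : tubeCross β (colourAvg f) g = tubeCross β f g := by
  obtain ⟨hJm, ⟨MJ, hJb⟩, hJinv⟩ := integral_avgKernel_mul_props β hg hCg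
  rw [tubeCross_eq_integral_mul, tubeCross_eq_integral_mul]
  exact integral_colourAvg_mul_invariant hf hCf hJm hJb fun c U => hJinv (fun _ => c) U

/-! ## §2 ★★★ The SLOW-WITH-RATE clause with potential from the DRESSED one-site no-intruder with potential -/

set_option maxHeartbeats 400000 in
/-- ★★★ **SLOW-WITH-RATE CLAUSE WITH POTENTIAL** (fixed `β`): (B-N) `|fibreMassAd − γ| ≤ κγ` on `𝒰`, (B-T)-rate upper against `⟨φW,K_BφW⟩`, the DRESSED one-site no-intruder
WITH POTENTIAL `hDOS` (factor `e^{ε'λ}`, coupling `κ_E`, window weight `D = 𝟙{orbitDist<δ₁}·orbitDist²`, norm undressed, no Gram condition), and the arithmetic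
`(1+κ)e^{ε'λ}μ_k + κμ₀ ≤ (1−κ)e^{ελ/4}μ_k` give `∃ a ≠ 0, tubeForm β (u_a) + κ_E·σμ₀·γ·∫D·G_a² ≤ e^{ελ/4}·σμ_k·‖u_a‖²_w` with `u_a = Σ aᵢ·boProjAd w Ω 𝒰 fᵢ` and
`G_a = Σ aᵢ·colourAvg (boCoeffAd w Ω 𝒰 fᵢ)`. [cite: Luscher1983, §3] [cite: SjostrandZworski2007, §2] -/
theorem slow_rate_clause_of_dressed_pot {β : ℝ} {w : GaugeConfig 3 L SU2 → ℝ} (hw : Measurable w) {Cw : ℝ} (hCw : ∀ U, |w U| ≤ Cw) (hw0 : ∀ U, 0 ≤ w U)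
    (hwinv : ∀ (c : SU2) (U : GaugeConfig 3 L SU2), w (gaugeTransform (fun _ : Site 3 L => c) U) = w U)
    {Ω : GaugeConfig 3 1 SU2 → LinkSpace L → ℝ} (hΩ : Measurable (Function.uncurry Ω)) {CΩ : ℝ} (hCΩ : ∀ u x, |Ω u x| ≤ CΩ)
    (hΩinv : ∀ (g : SU2) (u : GaugeConfig 3 1 SU2) (v : LinkSpace L), Ω (gaugeTransform (fun _ : Site 3 1 => g) u) (adL L g v) = Ω u v)
    {W : GaugeConfig 3 1 SU2 → ℝ}
    {𝒰 : Set (GaugeConfig 3 1 SU2)} (h𝒰 : MeasurableSet 𝒰) (h𝒰inv : ∀ (c : SU2) (u : GaugeConfig 3 1 SU2), gaugeTransform (fun _ : Site 3 1 => c) u ∈ 𝒰 ↔ u ∈ 𝒰)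
    {δ₁ : ℝ} (h𝒰δ : ∀ u ∈ 𝒰, orbitDist u < δ₁)
    {σ γ κ κE : ℝ} (hσ : 0 ≤ σ) (hγ : 0 < γ) (hκ0 : 0 ≤ κ) (hκ1 : κ < 1) (hκE : 0 ≤ κE)
    (hN : ∀ u ∈ 𝒰, |fibreMassAd L w Ω u - γ| ≤ κ * γ)
    (hT : ∀ φ : GaugeConfig 3 1 SU2 → ℝ, Measurable φ → (∃ C : ℝ, ∀ u, |φ u| ≤ C) → (∀ (g : Site 3 1 → SU2) (u : GaugeConfig 3 1 SU2), φ (gaugeTransform g u) = φ u) →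
      (∀ u, φ u ≠ 0 → u ∈ 𝒰) →
      tubeForm β (boFunAd L φ Ω) ≤ σ * γ * (1 + κ) * qform su2Rep ((L : ℝ) ^ 3 * β) (fun u => φ u * W u) (fun u => φ u * W u) +
        κ * σ * γ * levelValue su2Rep 1 ((L : ℝ) ^ 3 * β) 0 * l2 φ φ)
    {k : ℕ} {ε ε' : ℝ}
    (hDOS : ∀ G : Fin (k + 1) → (GaugeConfig 3 1 SU2 → ℝ), (∀ i, Measurable (G i)) → (∀ i, ∃ C : ℝ, ∀ U, |G i U| ≤ C) →
      (∀ i (g : Site 3 1 → SU2) (U : GaugeConfig 3 1 SU2), G i (gaugeTransform g U) = G i U) → (∀ i U, G i U ≠ 0 → orbitDist U < δ₁) →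
        ∃ a : Fin (k + 1) → ℝ, a ≠ 0 ∧
          (qform su2Rep ((L : ℝ) ^ 3 * β) (fun U => (∑ i, a i * G i U) * W U) (fun U => (∑ i, a i * G i U) * W U) +
              κE * levelValue su2Rep 1 ((L : ℝ) ^ 3 * β) 0 *
                ∫ U, (if orbitDist U < δ₁ then orbitDist U ^ 2 else 0) * (∑ i, a i * G i U) ^ 2 ∂configMeasure SU2 1) * levelValue su2Rep 1 ((L : ℝ) ^ 3 * β) 0 ≤
            Real.exp (ε' * bareLambda ((L : ℝ) ^ 3 * β)) * levelValue su2Rep 1 ((L : ℝ) ^ 3 * β) k * levelValue su2Rep 1 ((L : ℝ) ^ 3 * β) 0 *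
              l2 (fun U => ∑ i, a i * G i U) (fun U => ∑ i, a i * G i U))
    (hμ0 : 0 < levelValue su2Rep 1 ((L : ℝ) ^ 3 * β) 0) (hμk : 0 ≤ levelValue su2Rep 1 ((L : ℝ) ^ 3 * β) k)
    (harith : (1 + κ) * Real.exp (ε' * bareLambda ((L : ℝ) ^ 3 * β)) * levelValue su2Rep 1 ((L : ℝ) ^ 3 * β) k + κ * levelValue su2Rep 1 ((L : ℝ) ^ 3 * β) 0 ≤
      (1 - κ) * Real.exp (ε / 4 * bareLambda ((L : ℝ) ^ 3 * β)) * levelValue su2Rep 1 ((L : ℝ) ^ 3 * β) k)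
    {f : Fin (k + 1) → GaugeConfig 3 L SU2 → ℝ} (hfm : ∀ i, Measurable (f i)) (hfb : ∀ i, ∃ C : ℝ, ∀ U, |f i U| ≤ C) :
    ∃ a : Fin (k + 1) → ℝ, a ≠ 0 ∧
      tubeForm β (fun U => ∑ i, a i * boProjAd L w Ω 𝒰 (f i) U) +
          κE * (σ * levelValue su2Rep 1 ((L : ℝ) ^ 3 * β) 0) *
            (γ * ∫ u, (if orbitDist u < δ₁ then orbitDist u ^ 2 else 0) * (∑ i, a i * colourAvg (L := 1) (boCoeffAd L w Ω 𝒰 (f i)) u) ^ 2 ∂configMeasure SU2 1) ≤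
        Real.exp (ε / 4 * bareLambda ((L : ℝ) ^ 3 * β)) * (σ * levelValue su2Rep 1 ((L : ℝ) ^ 3 * β) k) *
          tubeNormSq w (fun U => ∑ i, a i * boProjAd L w Ω 𝒰 (f i) U) := by
  -- abbreviations
  set B : ℝ := (L : ℝ) ^ 3 * β with hB
  set μ0 : ℝ := levelValue su2Rep 1 B 0 with hμ0def
  set μk : ℝ := levelValue su2Rep 1 B k with hμkdef
  set lam : ℝ := bareLambda B with hlamdef
  have hκ1' : 0 < 1 - κ := by linarith
  -- fibre-mass lower bound on `𝒰`
  have hZ : ∀ u ∈ 𝒰, γ * (1 - κ) ≤ fibreMassAd L w Ω u := fun u hu => by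
    have := (abs_le.mp (hN u hu)).1; linarith
  have hZ₀ : 0 < γ * (1 - κ) := mul_pos hγ hκ1'
  -- the one-site amplitudes `φᵢ = boCoeffAd fᵢ` and their colour averages `Gᵢ`
  set φ : Fin (k + 1) → GaugeConfig 3 1 SU2 → ℝ := fun i => boCoeffAd L w Ω 𝒰 (f i) with hφdef
  have hφm : ∀ i, Measurable (φ i) := fun i => measurable_boCoeffAd hw hΩ h𝒰 (hfm i)
  choose Cf hCf using hfb
  have hφb : ∀ i, ∀ u, |φ i u| ≤ Cf i * CΩ * Cw * (orthoTransverse L).real Set.univ / (γ * (1 - κ)) := fun i =>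
    abs_boCoeffAd_le hCw hCΩ hZ₀ hZ (hCf i)
  have hφs : ∀ i u, φ i u ≠ 0 → u ∈ 𝒰 := fun i u hu => by
    by_contra hnu; exact hu (show boCoeffAd L w Ω 𝒰 (f i) u = 0 by unfold boCoeffAd; rw [Set.indicator_of_notMem hnu])
  set G : Fin (k + 1) → GaugeConfig 3 1 SU2 → ℝ := fun i => colourAvg (L := 1) (φ i) with hGdef
  have hGm : ∀ i, Measurable (G i) := fun i => measurable_colourAvg (hφm i)
  have hGb : ∀ i, ∃ C : ℝ, ∀ U, |G i U| ≤ C := fun i => ⟨_, abs_colourAvg_le (hφm i) (hφb i)⟩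
  have hGg : ∀ i (g : Site 3 1 → SU2) (U : GaugeConfig 3 1 SU2), G i (gaugeTransform g U) = G i U := fun i g U => colourAvg_one_site_gaugeInvariant (φ i) g U
  have hGs𝒰 : ∀ i u, G i u ≠ 0 → u ∈ 𝒰 := fun i u hu => by
    by_contra hnu
    exact hu (colourAvg_eq_zero_of_support (S := 𝒰) (fun c v => h𝒰inv c v) (fun v hv => by by_contra h; exact hv (hφs i v h)) hnu)
  have hGs : ∀ i U, G i U ≠ 0 → orbitDist U < δ₁ := fun i U hU => h𝒰δ U (hGs𝒰 i U hU)
  -- combinations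
  have hcombP : ∀ a : Fin (k + 1) → ℝ, (fun U => ∑ i, a i * boProjAd L w Ω 𝒰 (f i) U) = boFunAd L (fun u => ∑ i, a i * φ i u) Ω := fun a => by
    funext U
    rw [← boProjAd_sum hw hCw hΩ hCΩ 𝒰 a hfm (fun i => ⟨Cf i, hCf i⟩) U]
    unfold boProjAd
    rw [boCoeffAd_sum hw hCw hΩ hCΩ 𝒰 a hfm (fun i => ⟨Cf i, hCf i⟩) |> funext |> congrArg (fun φ' => boFunAd L φ' Ω U)]
  have hφam : ∀ a : Fin (k + 1) → ℝ, Measurable (fun u => ∑ i, a i * φ i u) := fun a => Finset.measurable_sum _ fun i _ => (hφm i).const_mul _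
  have hφab : ∀ a : Fin (k + 1) → ℝ, ∀ u, |∑ i, a i * φ i u| ≤ ∑ i, |a i| * (Cf i * CΩ * Cw * (orthoTransverse L).real Set.univ / (γ * (1 - κ))) := fun a u =>
    (Finset.abs_sum_le_sum_abs _ _).trans (Finset.sum_le_sum fun i _ => by rw [abs_mul]; exact mul_le_mul_of_nonneg_left (hφb i u) (abs_nonneg _))
  have hGa : ∀ a : Fin (k + 1) → ℝ, colourAvg (L := 1) (fun u => ∑ i, a i * φ i u) = fun u => ∑ i, a i * G i u := fun a =>
    funext fun u => colourAvg_sum a hφm (fun i => ⟨_, hφb i⟩) u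
  have hGam : ∀ a : Fin (k + 1) → ℝ, Measurable (fun u => ∑ i, a i * G i u) := fun a => Finset.measurable_sum _ fun i _ => (hGm i).const_mul _
  choose CG hCG using hGb
  have hGab : ∀ a : Fin (k + 1) → ℝ, ∀ u, |∑ i, a i * G i u| ≤ ∑ i, |a i| * CG i := fun a u =>
    (Finset.abs_sum_le_sum_abs _ _).trans (Finset.sum_le_sum fun i _ => by rw [abs_mul]; exact mul_le_mul_of_nonneg_left (hCG i u) (abs_nonneg _))
  have hGag : ∀ (a : Fin (k + 1) → ℝ) (g : Site 3 1 → SU2) (u : GaugeConfig 3 1 SU2), (∑ i, a i * G i (gaugeTransform g u)) = ∑ i, a i * G i u := fun a g u =>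
    Finset.sum_congr rfl fun i _ => by rw [hGg]
  have hGas : ∀ (a : Fin (k + 1) → ℝ) u, (∑ i, a i * G i u) ≠ 0 → u ∈ 𝒰 := fun a u hu => by
    by_contra hnu
    exact hu (Finset.sum_eq_zero fun i _ => by
      have : G i u = 0 := by by_contra h; exact hnu (hGs𝒰 i u h)
      rw [this, mul_zero])
  -- the potential is nonnegative
  have hD0 : ∀ u : GaugeConfig 3 1 SU2, 0 ≤ (if orbitDist u < δ₁ then orbitDist u ^ 2 else 0) := fun u => by split_ifs <;> positivity
  have hPot0 : ∀ a : Fin (k + 1) → ℝ, 0 ≤ ∫ u, (if orbitDist u < δ₁ then orbitDist u ^ 2 else 0) * (∑ i, a i * G i u) ^ 2 ∂configMeasure SU2 1 := fun a =>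
    integral_nonneg fun u => mul_nonneg (hD0 u) (sq_nonneg _)
  -- the key one-site inequality from the DRESSED no-intruder WITH POTENTIAL (no Gram condition)
  obtain ⟨a, ha, hk⟩ := hDOS G hGm (fun i => ⟨CG i, hCG i⟩) hGg hGs
  have hqa : qform su2Rep B (fun u => (∑ i, a i * G i u) * W u) (fun u => (∑ i, a i * G i u) * W u) +
      κE * μ0 * ∫ u, (if orbitDist u < δ₁ then orbitDist u ^ 2 else 0) * (∑ i, a i * G i u) ^ 2 ∂configMeasure SU2 1 ≤
      Real.exp (ε' * lam) * μk * l2 (fun u => ∑ i, a i * G i u) (fun u => ∑ i, a i * G i u) :=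
    le_of_mul_le_mul_right (by linarith [hk]) hμ0
  refine ⟨a, ha, ?_⟩
  -- form side: colour average, then the kernel brick (against the DRESSED one-site form)
  have hPm : Measurable (boFunAd L (fun u => ∑ i, a i * φ i u) Ω) := measurable_boFunAd L (hφam a) hΩ
  have hPb := abs_boFunAd_le L (hφab a) hCΩ
  have hform : tubeForm β (fun U => ∑ i, a i * boProjAd L w Ω 𝒰 (f i) U) ≤
      σ * γ * (1 + κ) * qform su2Rep B (fun u => (∑ i, a i * G i u) * W u) (fun u => (∑ i, a i * G i u) * W u) +
        κ * σ * γ * μ0 * l2 (fun u => ∑ i, a i * G i u) (fun u => ∑ i, a i * G i u) := by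
    rw [hcombP a, ← tubeForm_colourAvg β hPm hPb]
    have hc : colourAvg (boFunAd L (fun u => ∑ i, a i * φ i u) Ω) = boFunAd L (fun u => ∑ i, a i * G i u) Ω := by
      funext U; rw [colourAvg_boFunAd L _ hΩinv U, hGa a]
    rw [hc]
    exact hT _ (hGam a) ⟨_, hGab a⟩ (hGag a) (hGas a)
  -- norm side: colour average does not increase the norm; fibre mass ≥ γ(1−κ)
  have hnorm : γ * (1 - κ) * l2 (fun u => ∑ i, a i * G i u) (fun u => ∑ i, a i * G i u) ≤ tubeNormSq w (fun U => ∑ i, a i * boProjAd L w Ω 𝒰 (f i) U) := by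
    rw [hcombP a]
    have h1 : tubeNormSq w (colourAvg (boFunAd L (fun u => ∑ i, a i * φ i u) Ω)) ≤ tubeNormSq w (boFunAd L (fun u => ∑ i, a i * φ i u) Ω) :=
      tubeNormSq_colourAvg_le hw hCw hw0 hwinv hPm hPb
    have hc : colourAvg (boFunAd L (fun u => ∑ i, a i * φ i u) Ω) = boFunAd L (fun u => ∑ i, a i * G i u) Ω := by
      funext U; rw [colourAvg_boFunAd L _ hΩinv U, hGa a]
    rw [hc, tubeNormSq_boFunAd (hGam a) (hGab a) hΩ hCΩ hw hCw] at h1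
    refine le_trans ?_ h1
    rw [l2_self_eq_integral_sq, ← integral_const_mul]
    have hiL : Integrable (fun u => γ * (1 - κ) * (∑ i, a i * G i u) ^ 2) (configMeasure SU2 1) :=
      (integrable_of_measurable_abs_le _ ((hGam a).pow_const 2) (C := (∑ i, |a i| * CG i) ^ 2) fun u => by
        rw [abs_pow]; exact pow_le_pow_left₀ (abs_nonneg _) (hGab a u) 2).const_mul _
    have hM := measurable_fibreMassAd hw hΩ (L := L)
    have hMb : ∀ u, |fibreMassAd L w Ω u| ≤ CΩ ^ 2 * Cw * (orthoTransverse L).real Set.univ := fun u => by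
      haveI := isFiniteMeasure_orthoTransverse L
      unfold fibreMassAd
      have hCΩ0 : 0 ≤ CΩ := (abs_nonneg _).trans (hCΩ 1 0)
      calc |∫ v, Ω u (linkEmbed L v) ^ 2 * w (orthoTube L u v) ∂orthoTransverse L| ≤ ∫ v, |Ω u (linkEmbed L v) ^ 2 * w (orthoTube L u v)| ∂orthoTransverse L :=
            abs_integral_le_integral_abs
        _ ≤ ∫ _v, CΩ ^ 2 * Cw ∂orthoTransverse L := by
            refine integral_mono_of_nonneg (ae_of_all _ fun v => abs_nonneg _) (integrable_const _) (ae_of_all _ fun v => ?_)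
            show |Ω u (linkEmbed L v) ^ 2 * w (orthoTube L u v)| ≤ CΩ ^ 2 * Cw
            rw [abs_mul, abs_pow]
            exact mul_le_mul (pow_le_pow_left₀ (abs_nonneg _) (hCΩ _ _) 2) (hCw _) (abs_nonneg _) (by positivity)
        _ = CΩ ^ 2 * Cw * (orthoTransverse L).real Set.univ := by rw [integral_const, smul_eq_mul, mul_comm]
    have hiR : Integrable (fun u => (∑ i, a i * G i u) ^ 2 * fibreMassAd L w Ω u) (configMeasure SU2 1) :=
      integrable_of_measurable_abs_le _ (((hGam a).pow_const 2).mul hM) (C := (∑ i, |a i| * CG i) ^ 2 * (CΩ ^ 2 * Cw * (orthoTransverse L).real Set.univ))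
        fun u => by rw [abs_mul, abs_pow]; exact mul_le_mul (pow_le_pow_left₀ (abs_nonneg _) (hGab a u) 2) (hMb u) (abs_nonneg _) (by positivity)
    refine integral_mono hiL hiR fun u => ?_
    dsimp only
    by_cases hu : u ∈ 𝒰
    · have := hZ u hu; nlinarith [sq_nonneg (∑ i, a i * G i u)]
    · have h0 : (∑ i, a i * G i u) = 0 := by by_contra h; exact hu (hGas a u h)
      rw [h0]; simp
  -- arithmetic
  have hl2 : 0 ≤ l2 (fun u => ∑ i, a i * G i u) (fun u => ∑ i, a i * G i u) := l2_self_nonneg_lat _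
  set n := l2 (fun u => ∑ i, a i * G i u) (fun u => ∑ i, a i * G i u) with hndef
  set Pot := ∫ u, (if orbitDist u < δ₁ then orbitDist u ^ 2 else 0) * (∑ i, a i * G i u) ^ 2 ∂configMeasure SU2 1 with hPotdef
  have hPot0' : 0 ≤ Pot := hPot0 a
  have h1 : tubeForm β (fun U => ∑ i, a i * boProjAd L w Ω 𝒰 (f i) U) + κE * (σ * μ0) * (γ * Pot) ≤ σ * γ * ((1 + κ) * Real.exp (ε' * lam) * μk + κ * μ0) * n := by
    -- `κ_E σμ₀γ·Pot ≤ σγ(1+κ)·κ_Eμ₀·Pot`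
    have hp : κE * (σ * μ0) * (γ * Pot) ≤ σ * γ * (1 + κ) * (κE * μ0 * Pot) := by
      have e : σ * γ * (1 + κ) * (κE * μ0 * Pot) = κE * (σ * μ0) * (γ * Pot) + κ * (κE * (σ * μ0) * (γ * Pot)) := by ring
      rw [e]
      have : 0 ≤ κE * (σ * μ0) * (γ * Pot) := by positivity
      nlinarith [this, hκ0]
    have h2 := mul_le_mul_of_nonneg_left hqa (by positivity : 0 ≤ σ * γ * (1 + κ))
    have e2 : σ * γ * (1 + κ) * (qform su2Rep B (fun u => (∑ i, a i * G i u) * W u) (fun u => (∑ i, a i * G i u) * W u) + κE * μ0 * Pot) =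
        σ * γ * (1 + κ) * qform su2Rep B (fun u => (∑ i, a i * G i u) * W u) (fun u => (∑ i, a i * G i u) * W u) + σ * γ * (1 + κ) * (κE * μ0 * Pot) := by ring
    rw [e2] at h2
    have e3 : σ * γ * (1 + κ) * (Real.exp (ε' * lam) * μk * n) + κ * σ * γ * μ0 * n = σ * γ * ((1 + κ) * Real.exp (ε' * lam) * μk + κ * μ0) * n := by ring
    linarith [hform, hp, h2, e3]
  have h2 : σ * γ * ((1 + κ) * Real.exp (ε' * lam) * μk + κ * μ0) * n ≤ σ * γ * ((1 - κ) * Real.exp (ε / 4 * lam) * μk) * n :=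
    mul_le_mul_of_nonneg_right (mul_le_mul_of_nonneg_left harith (by positivity)) hl2
  have h3 : σ * γ * ((1 - κ) * Real.exp (ε / 4 * lam) * μk) * n = Real.exp (ε / 4 * lam) * (σ * μk) * (γ * (1 - κ) * n) := by ring
  have h4 : Real.exp (ε / 4 * lam) * (σ * μk) * (γ * (1 - κ) * n) ≤
      Real.exp (ε / 4 * lam) * (σ * μk) * tubeNormSq w (fun U => ∑ i, a i * boProjAd L w Ω 𝒰 (f i) U) :=
    mul_le_mul_of_nonneg_left hnorm (by positivity)
  linarith [h1, h2, h3, h4]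

end Summit.QuantumFields.YangMills.Theorems.FemtoTransferGap.RateTube

end
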